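import Summits.Ventures.Crystal3D.Theorems.StickyWulffConstantTextureLiminfTexShadowLevelReachCutSetShapeInv
import Summits.Ventures.Crystal3D.Theorems.StickyWulffConstantTextureLiminfTexShadowLevelReachBornRoot
import HarnessLib

/-!
# The ROOT-CLASS and BORN censuses WITHOUT the bottom core-rigidity hypothesis (`hstd` discharged by the all-cut invariant)
# (lane T, crux `TextureLiminfV5`, stmt-Ventures-23912, registered stub `stub_terraceCensus`; (β) assembly — born families of the filling's lamellae, cf-p1 (cccv)/(cccvii))

HONEST FRAMING. Venture `Summits/Ventures/Crystal3D` (cell `crystal3d-full`), route `route-Ventures-StickyWulffConstant`, helper `--supports` the law-v5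
crux `TextureLiminfV5` (stmt-Ventures-23912), lane T, mechanism (β).  Census-free, certificate-free; `KissingGap δ`, `KissingClassification δ` BY NAME; F-C1 not moved.

THE POINT.  `rootClass_endPairs_launch_root`, `born_endPairs_launch_root`, `bornMoving_endPairs_launch_root` (…LevelReachBornRoot, p749779) VERBATIM —
same conclusions, same proofs — with the hypothesis
`hstd : ∀ κ, WF κ → ∀ p ∈ P', (occupied F κ-face at p) → F κ (u κ) = F [] (u [])` (core rigidity of the bottom seal set `P'` for EVERY well-formed class)
REMOVED.  It is discharged internally: the census runs over `word_family_endPairs_launch_cuts_shape_inv` (…LevelReachCutSetShapeInv), which asks core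
rigidity only along the state invariant, and the all-cut invariant forces `κ = []`, where the clause reads `F [] (u []) = F [] (u [])`.
WHY IT MATTERS (the (β) assembly, memo HOME/wall-p1-g24/PRESENTABLE-SUPPLY-g24.md §3(b)/§4): the presentable born supply of the two-system census object sits in
the lamellae ADJACENT to the plates, launched in the one-letter frame `A₁ = Fr ≫ M_{μ₁}` along `c = A₁(−r)` (`r` a basal root of the plate frame `Fr`,
`⟪r, μ₁⟫ = √(2/3)`).  For that word system the well-formed class `[−μ₁]` has frame `A₁ ≫ M_{μ₁} = Fr` — the plate's own frame, whose faces ARE occupied at the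
plate's core balls — and direction `Fr r ≠ c`; so the removed clause was UNSATISFIABLE in the intended instantiation (the bottom seal set `P'` must contain the
plate band by `hsealB`), while everything else (`hP'top`, `hsealB`, the ROOT-frame top exclusion `hPexcl0root`, `hP₂seal`) is discharged by the clamped cell
exactly as for the plate censuses.  The presentation lemmas `isRootEndPair_of_rootMove` / `isEndPairA_of_rootMove` of …LevelReachBornRoot apply verbatim
to the exported pairs.
* `rootClass_endPairs_launch_root_free`, **`born_endPairs_launch_root_free`**, `bornMoving_endPairs_launch_root_free`.
WHAT THIS IS NOT: any lower bound on the number of born lines (born SUPPLY), the presentation `Adm` itself, the pooling, any certificate; F-C1 not moved.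
-/

noncomputable section

namespace Summit.Ventures.Crystal3D.Theorems

open Summit.Ventures.Crystal3D Finset
open Summit.Ventures.Crystal3D.Cruxes.TextureLiminf.TexShadow (E3)
open scoped InnerProductSpace

section RootLaunch

variable {X : Finset E3} {F : List E3 → (E3 ≃ₗᵢ[ℝ] E3)} {u : List E3 → E3} {WF : List E3 → Prop} {next : List E3 → E3 → List E3}
  {P' P₂ : Finset E3} {R₀ h ρ : ℝ}

open scoped Classical in
/-- **The root-class census from a launch set, every crossing cut — NO bottom core-rigidity hypothesis** (discharged by the invariant, see the module docstring).  Word data as in lane F's census; `C` cuts EVERY upward crossing letter of the root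
(`hC`, `hCall`); root-frame top exclusion `hPexcl0root`; launch set `L` of straight-moving root states with predecessor (`hLsrc`, no invariant clause) and
`p + c ∉ L` (`hLstep`); core / sealing verbatim.  Conclusion: `#L_window ≤ #T + #CUT + #REL₀ + 220·(#rim_top + #rim_bot)`, `REL₀` the STRAIGHT relaunches
only (predecessor a straight-moving window ball with its own predecessor present), `T` with lane F's exported properties (the end ball a certified root
state). -/
theorem rootClass_endPairs_launch_root_free (ver : WordVersion) {δ : ℝ} (hg : KissingGap δ) (hc : KissingClassification δ)
    (hX : ∀ p ∈ X, ∀ q ∈ X, p ≠ q → 1 ≤ dist p q)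
    (hFc : ∀ μ κ, F (μ :: κ) = ((ℝ ∙ μ)ᗮ.reflection).trans (F κ))
    (hu : ∀ κ, u κ ∈ fccSlots) (huc : ∀ μ κ, u (μ :: κ) = -u κ)
    (hWF0 : WF [])
    (hWFc : ∀ μ κ, WF (μ :: κ) ↔ (WF κ ∧ ‖μ‖ = 1 ∧
      (∀ w ∈ fccSlots, ⟪w, μ⟫_ℝ = 0 ∨ ⟪w, μ⟫_ℝ = Real.sqrt (2 / 3) ∨ ⟪w, μ⟫_ℝ = -Real.sqrt (2 / 3)) ∧
      ⟪u κ, μ⟫_ℝ = Real.sqrt (2 / 3) ∧ ∀ μ' κ', κ = μ' :: κ' → μ' ≠ -μ))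
    (hnext_pop : ∀ μ κ' (m : E3), (F (μ :: κ')).symm m = -μ → next (μ :: κ') m = κ')
    (hnext_push : ∀ κ (m : E3), (∀ μ κ', κ = μ :: κ' → (F κ).symm m ≠ -μ) → next κ m = (F κ).symm m :: κ)
    (C : E3 → Prop) (hC : ∀ μ, C μ → ⟪u [], μ⟫_ℝ = Real.sqrt (2 / 3))
    (hCall : ∀ m, IsMenuNormal (F []) m → ⟪F [] (u []), m⟫_ℝ = Real.sqrt (2 / 3) → C ((F []).symm m))
    (hPexcl0root : ∀ b : E3, b ∈ P₂ →
      (∃ a ∈ fccSlots, ∃ a' ∈ fccSlots, ∃ a'' ∈ fccSlots,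
        ⟪a, a'⟫_ℝ = 1 / 2 ∧ ⟪a, a''⟫_ℝ = 1 / 2 ∧ ⟪a', a''⟫_ℝ = 1 / 2 ∧
        b + F [] a ∈ X ∧ b + F [] a' ∈ X ∧ b + F [] a'' ∈ X) → False)
    (hup : 0 < (F [] (u [])) 2) (hR₀ : 3 ≤ R₀) (hρ : R₀ ≤ ρ)
    (L : Finset E3)
    (hLsrc : ∀ p ∈ L, p ∈ X ∧
      (∃ a ∈ fccSlots, ∃ a' ∈ fccSlots, ∃ a'' ∈ fccSlots,
        ⟪a, a'⟫_ℝ = 1 / 2 ∧ ⟪a, a''⟫_ℝ = 1 / 2 ∧ ⟪a', a''⟫_ℝ = 1 / 2 ∧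
        p + F [] a ∈ X ∧ p + F [] a' ∈ X ∧ p + F [] a'' ∈ X) ∧
      p - F [] (u []) ∈ X ∧
      (IsFull X (F []) p ∨ (∃ m, IsTwinReading X (F []) m p ∧ ⟪F [] (u []), m⟫_ℝ = 0) ∨
        (ver = WordVersion.v2 ∧ IsNarrow X (F []) (F [] (u [])) p)))
    (hLstep : ∀ p ∈ L, p + F [] (u []) ∉ L)
    (hP'top : ∀ p ∈ P', p 2 ≤ -R₀ - 1)
    (hsealB : ∀ s ∈ X, s ∉ P' → -R₀ - 1 - 1 ≤ s 2 → s 2 < -R₀ - 1 → s 0 ^ 2 + s 1 ^ 2 ≤ (ρ - 1) ^ 2 → False)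
    (hP₂seal : ∀ s ∈ X, h + R₀ + 1 ≤ s 2 → s 2 ≤ h + R₀ + 1 + 1 → s 0 ^ 2 + s 1 ^ 2 ≤ (ρ - 2) ^ 2 → s ∈ P₂) :
    ∃ T : Finset (E3 × E3),
      (L.filter fun p => -R₀ - 1 < (p + F [] (u [])) 2 ∧ (p + F [] (u [])) 2 < h + R₀ + 1).card ≤
        T.card +
        (X.filter fun b => -R₀ - 1 ≤ b 2 ∧ b 2 < h + R₀ + 1 ∧ (∃ μ, C μ ∧ IsTwinReading X (F []) (F [] μ) b) ∧ b - F [] (u []) ∈ X).card +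
        (L.filter fun p => -R₀ - 1 ≤ (p - F [] (u [])) 2 ∧ (p - F [] (u [])) 2 < h + R₀ + 1 ∧ p - F [] (u []) - F [] (u []) ∈ X ∧
            (IsFull X (F []) (p - F [] (u [])) ∨
              (∃ m, IsTwinReading X (F []) m (p - F [] (u [])) ∧ ⟪F [] (u []), m⟫_ℝ = 0) ∨
              (ver = WordVersion.v2 ∧ IsNarrow X (F []) (F [] (u [])) (p - F [] (u []))))).card +
        220 * (X.filter fun s => h + R₀ + 1 ≤ s 2 ∧ s 2 ≤ h + R₀ + 1 + 1 ∧ (ρ - 2) ^ 2 < s 0 ^ 2 + s 1 ^ 2).card +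
        220 * (X.filter fun s => -R₀ - 1 - 1 ≤ s 2 ∧ s 2 < -R₀ - 1 ∧ (ρ - 1) ^ 2 < s 0 ^ 2 + s 1 ^ 2).card ∧
      (∀ bq ∈ T, bq.1 ∈ X ∧ bq.2 ∈ X ∧ dist bq.1 bq.2 = 1 ∧ -R₀ - 1 ≤ bq.1 2 ∧ bq.1 2 < h + R₀ + 1) ∧
      (∀ bq ∈ T, (X.filter fun q => dist bq.1 q = 1).card ≤ 11 ∨
        ∃ z₁ ∈ X, ∃ z₂ ∈ X, z₁ ≠ z₂ ∧ dist bq.1 z₁ = 1 ∧ dist bq.1 z₂ = 1 ∧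
          (X.filter fun q => dist z₁ q = 1).card ≤ 11 ∧ (X.filter fun q => dist z₂ q = 1).card ≤ 11) ∧
      (∀ bq ∈ T, bq.1 - F [] (u []) ∈ X ∧ bq.2 = bq.1 - F [] (u []) ∧ ¬ IsMoving X ver (F []) (F [] (u [])) bq.1 ∧
        bq.2 - F [] (u []) ∈ X ∧ IsEndMove X ver (F []) (F [] (u [])) bq.2 bq.1) := by
  set P : E3 × List E3 → Prop := fun v => v.2 = [] ∧ (v.1 ∈ X ∧ v.1 - F v.2 (u v.2) ∈ X) ∧
    (IsFull X (F v.2) (v.1 - F v.2 (u v.2)) ∨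
      (∃ m, IsTwinReading X (F v.2) m (v.1 - F v.2 (u v.2)) ∧ ⟪F v.2 (u v.2), m⟫_ℝ = 0) ∨
      (ver = WordVersion.v2 ∧ IsNarrow X (F v.2) (F v.2 (u v.2)) (v.1 - F v.2 (u v.2)))) ∧
    v.1 - F v.2 (u v.2) - F v.2 (u v.2) ∈ X with hPdef
  have hPstraight : ∀ (b : E3) (κ : List E3), WF κ →
      (IsFull X (F κ) b ∨ (∃ m, IsTwinReading X (F κ) m b ∧ ⟪F κ (u κ), m⟫_ℝ = 0) ∨
        (ver = WordVersion.v2 ∧ IsNarrow X (F κ) (F κ (u κ)) b)) → P (b, κ) → P (b + F κ (u κ), κ) := by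
    rintro b κ - hmv ⟨hnil, hb, -, -⟩
    exact ⟨hnil, predInv_straight hu hmv hb, by rw [add_sub_cancel_right]; exact hmv, by rw [add_sub_cancel_right]; exact hb.2⟩
  have hPcross : ∀ (b : E3) (κ : List E3) (m : E3), WF κ → WF (next κ m) → IsTwinReading X (F κ) m b →
      ⟪F κ (u κ), m⟫_ℝ = Real.sqrt (2 / 3) → (κ ≠ [] ∨ ¬ C ((F []).symm m)) → P (b, κ) → P (b + F (next κ m) (u (next κ m)), next κ m) := by
    rintro b κ m - - htd hdm hoff ⟨hnil, -⟩
    exfalso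
    have hnil' : κ = [] := hnil
    subst hnil'
    rcases hoff with h0 | h0
    · exact h0 rfl
    · exact h0 (hCall m htd.1 hdm)
  have hPexcl0 : ∀ (b : E3) (κ : List E3), WF κ → P (b, κ) → b ∈ P₂ →
      (∃ a ∈ fccSlots, ∃ a' ∈ fccSlots, ∃ a'' ∈ fccSlots,
        ⟪a, a'⟫_ℝ = 1 / 2 ∧ ⟪a, a''⟫_ℝ = 1 / 2 ∧ ⟪a', a''⟫_ℝ = 1 / 2 ∧
        b + F κ a ∈ X ∧ b + F κ a' ∈ X ∧ b + F κ a'' ∈ X) → False := by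
    rintro b κ - ⟨hnil, -⟩ hb htri
    have hnil' : κ = [] := hnil
    subst hnil'
    exact hPexcl0root b hb htri
  have hLsrc' : ∀ p ∈ L, p ∈ X ∧
      (∃ a ∈ fccSlots, ∃ a' ∈ fccSlots, ∃ a'' ∈ fccSlots,
        ⟪a, a'⟫_ℝ = 1 / 2 ∧ ⟪a, a''⟫_ℝ = 1 / 2 ∧ ⟪a', a''⟫_ℝ = 1 / 2 ∧
        p + F [] a ∈ X ∧ p + F [] a' ∈ X ∧ p + F [] a'' ∈ X) ∧
      p - F [] (u []) ∈ X ∧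
      (IsFull X (F []) p ∨ (∃ m, IsTwinReading X (F []) m p ∧ ⟪F [] (u []), m⟫_ℝ = 0) ∨
        (ver = WordVersion.v2 ∧ IsNarrow X (F []) (F [] (u [])) p)) ∧
      P (p + F [] (u []), []) := by
    intro p hp
    obtain ⟨hpX, hface, hpred, hmv⟩ := hLsrc p hp
    exact ⟨hpX, hface, hpred, hmv, rfl, predInv_straight hu hmv ⟨hpX, hpred⟩, by rw [add_sub_cancel_right]; exact hmv,
      by rw [add_sub_cancel_right]; exact hpred⟩
  -- core rigidity along the invariant: the invariant forces the root class, where the clause is `rfl`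
  have hstd : ∀ κ, WF κ → ∀ p ∈ P', P (p, κ) → (∃ a ∈ fccSlots, ∃ a' ∈ fccSlots, ∃ a'' ∈ fccSlots,
        ⟪a, a'⟫_ℝ = 1 / 2 ∧ ⟪a, a''⟫_ℝ = 1 / 2 ∧ ⟪a', a''⟫_ℝ = 1 / 2 ∧
        p + F κ a ∈ X ∧ p + F κ a' ∈ X ∧ p + F κ a'' ∈ X) → F κ (u κ) = F [] (u []) := by
    rintro κ - p - ⟨hnil, -⟩ -
    have hnil' : κ = [] := hnil
    subst hnil'
    rfl
  obtain ⟨T, hbound, h1, h2, h3, -⟩ := word_family_endPairs_launch_cuts_shape_inv ver hg hc hX hFc hu huc hWF0 hWFc hnext_pop hnext_push C hC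
    hPstraight hPcross hPexcl0 hup hR₀ hρ L hLsrc' hLstep hP'top hstd hsealB hP₂seal
  refine ⟨T, hbound.trans ?_, h1, h2, ?_⟩
  · refine Nat.add_le_add_right (Nat.add_le_add_right (Nat.add_le_add (Nat.add_le_add_left (card_le_card fun b hb => ?_) _)
      (card_le_card fun p hp => ?_)) _) _
    · -- drop the invariant clause from the cut term
      simp only [Finset.mem_filter] at hb ⊢
      exact ⟨hb.1, hb.2.1, hb.2.2.1, hb.2.2.2.1, hb.2.2.2.2.2⟩
    · -- the relaunch term: the cross case is vacuous (every crossing letter is cut), the straight case reads the predecessor invariant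
      simp only [Finset.mem_filter] at hp ⊢
      obtain ⟨hpL, hrel⟩ := hp
      rcases hrel with ⟨⟨-, ⟨-, hpp⟩, -, -⟩, hlo, hhi, hmv⟩ | ⟨μ, hwf, hne, -, -, -, m, -, -, -⟩
      · exact ⟨hpL, hlo, hhi, hpp, hmv⟩
      · obtain ⟨-, hμ1, hμmenu, hwμ, -⟩ := (hWFc μ []).1 hwf
        exact absurd (hCall (F [] μ) ⟨by rw [LinearIsometryEquiv.norm_map, hμ1], fun w hw => by
          rw [LinearIsometryEquiv.inner_map_map]; exact hμmenu w hw⟩ (by rw [LinearIsometryEquiv.inner_map_map, hwμ]))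
          (by rw [LinearIsometryEquiv.symm_apply_apply]; exact hne)
  · -- the ROOT-CLASS end move: the invariant forces `κ = []` and carries the mover's straight reading and predecessor
    intro bq hbq
    obtain ⟨κ, -, ⟨hnil, ⟨-, hpred⟩, hread, hpp⟩, hshape, hnm⟩ := h3 bq hbq
    have hnil' : κ = [] := hnil
    subst hnil'
    rw [← hshape] at hread hpp
    refine ⟨hpred, hshape, hnm, hpp, Or.inl ⟨?_, by rw [hshape, sub_add_cancel], hnm⟩⟩
    rcases hread with hfull | hgl | hnar
    · exact Or.inl hfull
    · exact Or.inr (Or.inr hgl)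
    · exact Or.inr (Or.inl hnar)

open scoped Classical in
/-- **BORN LINES have no relaunch term — NO bottom core-rigidity hypothesis.**  A launch set of straight-moving root states (FULL in the root frame, say the first trackable ball above an
incoherent patch) whose predecessor `p − c` is present but is NOT itself a straight-moving state with its own predecessor present (`hborn`) is never
stepped onto by a tracked walk: with every crossing letter cut, `#L_window ≤ #T + #CUT + 220·(#rim_top + #rim_bot)`. -/
theorem born_endPairs_launch_root_free (ver : WordVersion) {δ : ℝ} (hg : KissingGap δ) (hc : KissingClassification δ)
    (hX : ∀ p ∈ X, ∀ q ∈ X, p ≠ q → 1 ≤ dist p q)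
    (hFc : ∀ μ κ, F (μ :: κ) = ((ℝ ∙ μ)ᗮ.reflection).trans (F κ))
    (hu : ∀ κ, u κ ∈ fccSlots) (huc : ∀ μ κ, u (μ :: κ) = -u κ)
    (hWF0 : WF [])
    (hWFc : ∀ μ κ, WF (μ :: κ) ↔ (WF κ ∧ ‖μ‖ = 1 ∧
      (∀ w ∈ fccSlots, ⟪w, μ⟫_ℝ = 0 ∨ ⟪w, μ⟫_ℝ = Real.sqrt (2 / 3) ∨ ⟪w, μ⟫_ℝ = -Real.sqrt (2 / 3)) ∧
      ⟪u κ, μ⟫_ℝ = Real.sqrt (2 / 3) ∧ ∀ μ' κ', κ = μ' :: κ' → μ' ≠ -μ))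
    (hnext_pop : ∀ μ κ' (m : E3), (F (μ :: κ')).symm m = -μ → next (μ :: κ') m = κ')
    (hnext_push : ∀ κ (m : E3), (∀ μ κ', κ = μ :: κ' → (F κ).symm m ≠ -μ) → next κ m = (F κ).symm m :: κ)
    (C : E3 → Prop) (hC : ∀ μ, C μ → ⟪u [], μ⟫_ℝ = Real.sqrt (2 / 3))
    (hCall : ∀ m, IsMenuNormal (F []) m → ⟪F [] (u []), m⟫_ℝ = Real.sqrt (2 / 3) → C ((F []).symm m))
    (hPexcl0root : ∀ b : E3, b ∈ P₂ →
      (∃ a ∈ fccSlots, ∃ a' ∈ fccSlots, ∃ a'' ∈ fccSlots,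
        ⟪a, a'⟫_ℝ = 1 / 2 ∧ ⟪a, a''⟫_ℝ = 1 / 2 ∧ ⟪a', a''⟫_ℝ = 1 / 2 ∧
        b + F [] a ∈ X ∧ b + F [] a' ∈ X ∧ b + F [] a'' ∈ X) → False)
    (hup : 0 < (F [] (u [])) 2) (hR₀ : 3 ≤ R₀) (hρ : R₀ ≤ ρ)
    -- the BORN launch set: full root-frame balls with predecessor present, the predecessor NOT a trackable straight mover
    (L : Finset E3)
    (hborn : ∀ p ∈ L, p ∈ X ∧ IsFull X (F []) p ∧ p - F [] (u []) ∈ X ∧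
      ¬ (p - F [] (u []) - F [] (u []) ∈ X ∧
        (IsFull X (F []) (p - F [] (u [])) ∨ (∃ m, IsTwinReading X (F []) m (p - F [] (u [])) ∧ ⟪F [] (u []), m⟫_ℝ = 0) ∨
          (ver = WordVersion.v2 ∧ IsNarrow X (F []) (F [] (u [])) (p - F [] (u []))))))
    (hP'top : ∀ p ∈ P', p 2 ≤ -R₀ - 1)
    (hsealB : ∀ s ∈ X, s ∉ P' → -R₀ - 1 - 1 ≤ s 2 → s 2 < -R₀ - 1 → s 0 ^ 2 + s 1 ^ 2 ≤ (ρ - 1) ^ 2 → False)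
    (hP₂seal : ∀ s ∈ X, h + R₀ + 1 ≤ s 2 → s 2 ≤ h + R₀ + 1 + 1 → s 0 ^ 2 + s 1 ^ 2 ≤ (ρ - 2) ^ 2 → s ∈ P₂) :
    ∃ T : Finset (E3 × E3),
      (L.filter fun p => -R₀ - 1 < (p + F [] (u [])) 2 ∧ (p + F [] (u [])) 2 < h + R₀ + 1).card ≤
        T.card +
        (X.filter fun b => -R₀ - 1 ≤ b 2 ∧ b 2 < h + R₀ + 1 ∧ (∃ μ, C μ ∧ IsTwinReading X (F []) (F [] μ) b) ∧ b - F [] (u []) ∈ X).card +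
        220 * (X.filter fun s => h + R₀ + 1 ≤ s 2 ∧ s 2 ≤ h + R₀ + 1 + 1 ∧ (ρ - 2) ^ 2 < s 0 ^ 2 + s 1 ^ 2).card +
        220 * (X.filter fun s => -R₀ - 1 - 1 ≤ s 2 ∧ s 2 < -R₀ - 1 ∧ (ρ - 1) ^ 2 < s 0 ^ 2 + s 1 ^ 2).card ∧
      (∀ bq ∈ T, bq.1 ∈ X ∧ bq.2 ∈ X ∧ dist bq.1 bq.2 = 1 ∧ -R₀ - 1 ≤ bq.1 2 ∧ bq.1 2 < h + R₀ + 1) ∧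
      (∀ bq ∈ T, (X.filter fun q => dist bq.1 q = 1).card ≤ 11 ∨
        ∃ z₁ ∈ X, ∃ z₂ ∈ X, z₁ ≠ z₂ ∧ dist bq.1 z₁ = 1 ∧ dist bq.1 z₂ = 1 ∧
          (X.filter fun q => dist z₁ q = 1).card ≤ 11 ∧ (X.filter fun q => dist z₂ q = 1).card ≤ 11) ∧
      (∀ bq ∈ T, bq.1 - F [] (u []) ∈ X ∧ bq.2 = bq.1 - F [] (u []) ∧ ¬ IsMoving X ver (F []) (F [] (u [])) bq.1 ∧
        bq.2 - F [] (u []) ∈ X ∧ IsEndMove X ver (F []) (F [] (u [])) bq.2 bq.1) := by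
  have hLsrc : ∀ p ∈ L, p ∈ X ∧
      (∃ a ∈ fccSlots, ∃ a' ∈ fccSlots, ∃ a'' ∈ fccSlots,
        ⟪a, a'⟫_ℝ = 1 / 2 ∧ ⟪a, a''⟫_ℝ = 1 / 2 ∧ ⟪a', a''⟫_ℝ = 1 / 2 ∧
        p + F [] a ∈ X ∧ p + F [] a' ∈ X ∧ p + F [] a'' ∈ X) ∧
      p - F [] (u []) ∈ X ∧
      (IsFull X (F []) p ∨ (∃ m, IsTwinReading X (F []) m p ∧ ⟪F [] (u []), m⟫_ℝ = 0) ∨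
        (ver = WordVersion.v2 ∧ IsNarrow X (F []) (F [] (u [])) p)) := by
    intro p hp
    obtain ⟨hpX, hfull, hpred, -⟩ := hborn p hp
    exact ⟨hpX, face_of_isFull (F []) hfull, hpred, Or.inl hfull⟩
  -- a full ball's successor is never a born launch (its predecessor would be a trackable straight mover)
  have hLstep : ∀ p ∈ L, p + F [] (u []) ∉ L := by
    intro p hp hmem
    obtain ⟨hpX, hfull, hpred, -⟩ := hborn p hp
    obtain ⟨-, -, -, hno⟩ := hborn _ hmem
    rw [add_sub_cancel_right] at hno
    exact hno ⟨hpred, Or.inl hfull⟩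
  obtain ⟨T, hbound, h1, h2, h3⟩ := rootClass_endPairs_launch_root_free ver hg hc hX hFc hu huc hWF0 hWFc hnext_pop hnext_push C hC hCall
    hPexcl0root hup hR₀ hρ L hLsrc hLstep hP'top hsealB hP₂seal
  refine ⟨T, hbound.trans ?_, h1, h2, h3⟩
  -- the straight relaunch term is EMPTY for born launches
  rw [Finset.card_eq_zero.2 ((Finset.filter_eq_empty_iff (s := L)).2 ?_), add_zero]
  intro p hp hrel
  obtain ⟨-, -, -, hno⟩ := hborn p hp
  exact hno ⟨hrel.2.2.1, hrel.2.2.2⟩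

open scoped Classical in
/-- **BORN LINES with any straight-moving launch ball — NO bottom core-rigidity hypothesis** (FULL, or a GLIDE reading, or — version `v2` — NARROW): the born basal GLIDE lines of an hcp-like
lamella are the ones that exist on edge-on cells (memo §4(c)).  Launch balls: in `X`, straight-moving along the root, an occupied root-frame face, predecessor
present but NOT a trackable straight mover with its own predecessor (`hborn`).  No relaunch term: `#L_window ≤ #T + #CUT + 220·(#rim_top + #rim_bot)`. -/
theorem bornMoving_endPairs_launch_root_free (ver : WordVersion) {δ : ℝ} (hg : KissingGap δ) (hc : KissingClassification δ)
    (hX : ∀ p ∈ X, ∀ q ∈ X, p ≠ q → 1 ≤ dist p q)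
    (hFc : ∀ μ κ, F (μ :: κ) = ((ℝ ∙ μ)ᗮ.reflection).trans (F κ))
    (hu : ∀ κ, u κ ∈ fccSlots) (huc : ∀ μ κ, u (μ :: κ) = -u κ)
    (hWF0 : WF [])
    (hWFc : ∀ μ κ, WF (μ :: κ) ↔ (WF κ ∧ ‖μ‖ = 1 ∧
      (∀ w ∈ fccSlots, ⟪w, μ⟫_ℝ = 0 ∨ ⟪w, μ⟫_ℝ = Real.sqrt (2 / 3) ∨ ⟪w, μ⟫_ℝ = -Real.sqrt (2 / 3)) ∧
      ⟪u κ, μ⟫_ℝ = Real.sqrt (2 / 3) ∧ ∀ μ' κ', κ = μ' :: κ' → μ' ≠ -μ))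
    (hnext_pop : ∀ μ κ' (m : E3), (F (μ :: κ')).symm m = -μ → next (μ :: κ') m = κ')
    (hnext_push : ∀ κ (m : E3), (∀ μ κ', κ = μ :: κ' → (F κ).symm m ≠ -μ) → next κ m = (F κ).symm m :: κ)
    (C : E3 → Prop) (hC : ∀ μ, C μ → ⟪u [], μ⟫_ℝ = Real.sqrt (2 / 3))
    (hCall : ∀ m, IsMenuNormal (F []) m → ⟪F [] (u []), m⟫_ℝ = Real.sqrt (2 / 3) → C ((F []).symm m))
    (hPexcl0root : ∀ b : E3, b ∈ P₂ →
      (∃ a ∈ fccSlots, ∃ a' ∈ fccSlots, ∃ a'' ∈ fccSlots,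
        ⟪a, a'⟫_ℝ = 1 / 2 ∧ ⟪a, a''⟫_ℝ = 1 / 2 ∧ ⟪a', a''⟫_ℝ = 1 / 2 ∧
        b + F [] a ∈ X ∧ b + F [] a' ∈ X ∧ b + F [] a'' ∈ X) → False)
    (hup : 0 < (F [] (u [])) 2) (hR₀ : 3 ≤ R₀) (hρ : R₀ ≤ ρ)
    (L : Finset E3)
    (hborn : ∀ p ∈ L, p ∈ X ∧
      (IsFull X (F []) p ∨ (∃ m, IsTwinReading X (F []) m p ∧ ⟪F [] (u []), m⟫_ℝ = 0) ∨
        (ver = WordVersion.v2 ∧ IsNarrow X (F []) (F [] (u [])) p)) ∧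
      (∃ a ∈ fccSlots, ∃ a' ∈ fccSlots, ∃ a'' ∈ fccSlots,
        ⟪a, a'⟫_ℝ = 1 / 2 ∧ ⟪a, a''⟫_ℝ = 1 / 2 ∧ ⟪a', a''⟫_ℝ = 1 / 2 ∧
        p + F [] a ∈ X ∧ p + F [] a' ∈ X ∧ p + F [] a'' ∈ X) ∧
      p - F [] (u []) ∈ X ∧
      ¬ (p - F [] (u []) - F [] (u []) ∈ X ∧
        (IsFull X (F []) (p - F [] (u [])) ∨ (∃ m, IsTwinReading X (F []) m (p - F [] (u [])) ∧ ⟪F [] (u []), m⟫_ℝ = 0) ∨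
          (ver = WordVersion.v2 ∧ IsNarrow X (F []) (F [] (u [])) (p - F [] (u []))))))
    (hP'top : ∀ p ∈ P', p 2 ≤ -R₀ - 1)
    (hsealB : ∀ s ∈ X, s ∉ P' → -R₀ - 1 - 1 ≤ s 2 → s 2 < -R₀ - 1 → s 0 ^ 2 + s 1 ^ 2 ≤ (ρ - 1) ^ 2 → False)
    (hP₂seal : ∀ s ∈ X, h + R₀ + 1 ≤ s 2 → s 2 ≤ h + R₀ + 1 + 1 → s 0 ^ 2 + s 1 ^ 2 ≤ (ρ - 2) ^ 2 → s ∈ P₂) :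
    ∃ T : Finset (E3 × E3),
      (L.filter fun p => -R₀ - 1 < (p + F [] (u [])) 2 ∧ (p + F [] (u [])) 2 < h + R₀ + 1).card ≤
        T.card +
        (X.filter fun b => -R₀ - 1 ≤ b 2 ∧ b 2 < h + R₀ + 1 ∧ (∃ μ, C μ ∧ IsTwinReading X (F []) (F [] μ) b) ∧ b - F [] (u []) ∈ X).card +
        220 * (X.filter fun s => h + R₀ + 1 ≤ s 2 ∧ s 2 ≤ h + R₀ + 1 + 1 ∧ (ρ - 2) ^ 2 < s 0 ^ 2 + s 1 ^ 2).card +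
        220 * (X.filter fun s => -R₀ - 1 - 1 ≤ s 2 ∧ s 2 < -R₀ - 1 ∧ (ρ - 1) ^ 2 < s 0 ^ 2 + s 1 ^ 2).card ∧
      (∀ bq ∈ T, bq.1 ∈ X ∧ bq.2 ∈ X ∧ dist bq.1 bq.2 = 1 ∧ -R₀ - 1 ≤ bq.1 2 ∧ bq.1 2 < h + R₀ + 1) ∧
      (∀ bq ∈ T, (X.filter fun q => dist bq.1 q = 1).card ≤ 11 ∨
        ∃ z₁ ∈ X, ∃ z₂ ∈ X, z₁ ≠ z₂ ∧ dist bq.1 z₁ = 1 ∧ dist bq.1 z₂ = 1 ∧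
          (X.filter fun q => dist z₁ q = 1).card ≤ 11 ∧ (X.filter fun q => dist z₂ q = 1).card ≤ 11) ∧
      (∀ bq ∈ T, bq.1 - F [] (u []) ∈ X ∧ bq.2 = bq.1 - F [] (u []) ∧ ¬ IsMoving X ver (F []) (F [] (u [])) bq.1 ∧
        bq.2 - F [] (u []) ∈ X ∧ IsEndMove X ver (F []) (F [] (u [])) bq.2 bq.1) := by
  have hLsrc : ∀ p ∈ L, p ∈ X ∧
      (∃ a ∈ fccSlots, ∃ a' ∈ fccSlots, ∃ a'' ∈ fccSlots,
        ⟪a, a'⟫_ℝ = 1 / 2 ∧ ⟪a, a''⟫_ℝ = 1 / 2 ∧ ⟪a', a''⟫_ℝ = 1 / 2 ∧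
        p + F [] a ∈ X ∧ p + F [] a' ∈ X ∧ p + F [] a'' ∈ X) ∧
      p - F [] (u []) ∈ X ∧
      (IsFull X (F []) p ∨ (∃ m, IsTwinReading X (F []) m p ∧ ⟪F [] (u []), m⟫_ℝ = 0) ∨
        (ver = WordVersion.v2 ∧ IsNarrow X (F []) (F [] (u [])) p)) := by
    intro p hp
    obtain ⟨hpX, hmv, hface, hpred, -⟩ := hborn p hp
    exact ⟨hpX, hface, hpred, hmv⟩
  have hLstep : ∀ p ∈ L, p + F [] (u []) ∉ L := by
    intro p hp hmem
    obtain ⟨-, hmv, -, hpred, -⟩ := hborn p hp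
    obtain ⟨-, -, -, -, hno⟩ := hborn _ hmem
    rw [add_sub_cancel_right] at hno
    exact hno ⟨hpred, hmv⟩
  obtain ⟨T, hbound, h1, h2, h3⟩ := rootClass_endPairs_launch_root_free ver hg hc hX hFc hu huc hWF0 hWFc hnext_pop hnext_push C hC hCall
    hPexcl0root hup hR₀ hρ L hLsrc hLstep hP'top hsealB hP₂seal
  refine ⟨T, hbound.trans ?_, h1, h2, h3⟩
  rw [Finset.card_eq_zero.2 ((Finset.filter_eq_empty_iff (s := L)).2 ?_), add_zero]
  intro p hp hrel
  obtain ⟨-, -, -, -, hno⟩ := hborn p hp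
  exact hno ⟨hrel.2.2.1, hrel.2.2.2⟩

end RootLaunch

end Summit.Ventures.Crystal3D.Theorems

end
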